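import Summits.QuantumFields.BalabanUV.T4Continuum.Support.AveragingDeficitResidualPairing

/-!
# AveragingDeficitTransportCalc (T⁴ programme, node NE3, row NE3-R2, gen 2) — CALCULUS OF THE LINEARISED TRANSPORT FOR
# THE LIFT γ: `J_X` as the differential of `exp` (linear, near the identity injective with `(1 − 15|X|)|Y| ≤ |J_X(Y)|`),
# linearity / locality / support rules of `(δ_ψV)(Γ)`, `δ` of a reversed word, the bonds of segments and tree words, and
# the transport derivative of a segment carrying ONE live bond (file 1/3 of the non-abelian lift; file 2 = the
# differential of (42) is linear and local in the direction, file 3 = the face-bond lift)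

HONEST FRAMING (cell `pub-balaban`, T4-DAG PAGE 1; unit `b2b-balaban-t4-ne3r2-p1` = owner of BINDER-OWNERS row NE3-R2,
gen 2).  The cell's T4 target is the finite-torus continuum limit of the unit-scale averaged loop expectations — NOT
infinite volume, NO mass gap, NOT Clay, NOT summit progress.  On the NE3 energy route the residual pairing
(`AveragingDeficitResidualPairing.residualPairing_torus`, this unit) bounds `⟨J(V̄), Φ⟩` for the push-forward directions
`Φ = pushDir L V ψ` by the proved wall β-per; to bound the residual against ALL coarse directions `φ` one needs the LIFT
(input γ of `T4ConvexResponse.dualResidual_le`; record `t4/T4-EST-NE3-P2.md` §4 (γ1)): a right inverse `φ ↦ ψ` of the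
differential of Bałaban's non-linear average (42) with `|ψ| ≤ Λ|φ|`.  This file is the word-level calculus for it; every
statement is [folklore] matrix / lattice bookkeeping on the tree's transcriptions (`B7Prop1Explicit.hol/seg/treeWord`,
session 1's `AveragingDeficitTransport.dhol` and `AveragingDeficitSideDeriv.jexp`, the tree's d-exp formula
`Literature.Analysis.Calculus.ExpDuhamel.fderiv_exp_apply_eq_exp_mul_integral`).  WHAT IS HERE (0 sorry): §1 `jexp_eq_fderiv`
(`J_X(Y) = e^{−X}·D exp_X(Y)`), `jexp_add/smul/zero/sub/sum`, `norm_le_norm_jexp` (`(1 − 15|X|)|Y| ≤ |J_X Y|`, `|X| ≤ 1`),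
`jexp_injective`; §2 `dhol_add/smul/neg` (session 1's `Ad_zero`/`Ad_add` bookkeeping), `dhol_eq_zero_of_forall` (vanishing on the bonds of the word), `dhol_congr`,
`dhol_revWord` (`δ(Γ⁻¹) = −Ad_{V(Γ)⁻¹} δ(Γ)`); §3 `bondsOf_append`, the bonds of forward / backward segments, the bonds of a
tree word with non-negative offsets stay below the offsets (`bondsOf_treeWord_lt`); §4 `dhol_seg_single` (a forward
segment with one live bond `b` transports `Ad_{V(Γ_{≤b})}ψ(b)`), `dhol_seg_neg_head` (a backward segment whose only live
bond is the first gives `−ψ(b)`).  NE3 ITSELF IS NOT PROVED (energy route: NE3(A) ⇐ ML ∧ R0 ∧ β ∧ γ); NE3 stays COND-free.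
CITATION HEADER: no printed sentence is a hypothesis; the manuscripts under audit are not cited for any disputed step;
context: T. Bałaban, Commun. Math. Phys. **98** (1985) 17–51 [Balaban1985Averaging] ((9) p. 18, (42) p. 23);
B. C. Hall, Lie Groups, Lie Algebras, and Representations (2015), Thm 5.4 [Hall2015] (derivative of `exp`, via the tree).
PLACEMENT: `Summits/QuantumFields/BalabanUV/` (human rule 2026-08-19).  Record: HOME `t4/T4-EST-NE3-R2.md` v0.3.
-/

set_option autoImplicit false

open scoped BigOperators Matrix Matrix.Norms.L2Operator Topology
open NormedSpace Finset Filter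

namespace Summit.QuantumFields.BalabanUV.T4Continuum.AveragingDeficitTransportCalc

open Literature.MathematicalPhysics.QuantumFieldTheory.Balaban1983to89
open B7Prop1Explicit B7Prop2Explicit MatrixLog UnitaryModel
open T4AveragingDeficitWall hiding Site Plane Plaq Bond
open T4AveragingDeficitNonAbelian (Ad_mul Ad_sub)
open AveragingDeficitTransport AveragingDeficitLocality AveragingDeficitNearIdentity AveragingDeficitSideDeriv
open AveragingDeficitPlaqDeriv
open Literature.Analysis.Calculus (fderiv_exp_apply_eq_exp_mul_integral)

noncomputable section

variable {d : ℕ} {n : Type*} [Fintype n] [DecidableEq n]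

local notation "𝕄" => Matrix n n ℂ
local notation "Site" => B7Prop1Explicit.Site

/-! ## §1 `J_X` is the (left-trivialised) differential of `exp`: linearity and near-identity injectivity -/

/-- **`J_X(Y) = e^{−X} · D exp_X (Y)`** (Hall 2015 Thm 5.4 via the tree's `fderiv_exp_apply_eq_exp_mul_integral`).
[cite: Hall2015, Theorem 5.4] -/
theorem jexp_eq_fderiv (X Y : 𝕄) : jexp X Y = exp (-X) * (fderiv ℝ exp X) Y := by
  letI : NormedAlgebra ℚ 𝕄 := NormedAlgebra.restrictScalars ℚ ℝ 𝕄
  have h : (fderiv ℝ exp X) Y = exp X * jexp X Y := fderiv_exp_apply_eq_exp_mul_integral X Y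
  have hinv : exp (-X) * exp X = (1 : 𝕄) := by
    have h1 := (expUnit X).inv_mul
    rwa [val_inv_expUnit, val_expUnit] at h1
  rw [h, ← mul_assoc, hinv, one_mul]

/-- `J_X` is additive in `Y`. [folklore] -/
theorem jexp_add (X Y Z : 𝕄) : jexp X (Y + Z) = jexp X Y + jexp X Z := by
  rw [jexp_eq_fderiv, jexp_eq_fderiv, jexp_eq_fderiv, map_add, mul_add]

/-- `J_X` is real-homogeneous in `Y`. [folklore] -/
theorem jexp_smul (X : 𝕄) (c : ℝ) (Y : 𝕄) : jexp X (c • Y) = c • jexp X Y := by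
  rw [jexp_eq_fderiv, jexp_eq_fderiv, map_smul, mul_smul_comm]

/-- `J_X(0) = 0`. [folklore] -/
theorem jexp_zero (X : 𝕄) : jexp X 0 = 0 := by
  rw [jexp_eq_fderiv, map_zero, mul_zero]

/-- `J_X` is subtractive in `Y`. [folklore] -/
theorem jexp_sub (X Y Z : 𝕄) : jexp X (Y - Z) = jexp X Y - jexp X Z := by
  rw [jexp_eq_fderiv, jexp_eq_fderiv, jexp_eq_fderiv, map_sub, mul_sub]

/-- `J_X` commutes with finite sums. [folklore] -/
theorem jexp_sum {ι : Type*} (X : 𝕄) (s : Finset ι) (Y : ι → 𝕄) :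
    jexp X (∑ i ∈ s, Y i) = ∑ i ∈ s, jexp X (Y i) := by
  classical
  induction s using Finset.induction_on with
  | empty => simp [jexp_zero]
  | insert a s ha ih => rw [Finset.sum_insert ha, Finset.sum_insert ha, jexp_add, ih]

/-- **NEAR THE IDENTITY `J_X` IS BOUNDED BELOW**: `(1 − 15|X|)·|Y| ≤ |J_X(Y)|` for `|X| ≤ 1` (from session 1's
`|J_X(Y) − Y| ≤ 15|X||Y|`). [folklore] -/
theorem norm_le_norm_jexp (X Y : 𝕄) (hX : ‖X‖ ≤ 1) : (1 - 15 * ‖X‖) * ‖Y‖ ≤ ‖jexp X Y‖ := by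
  have h := norm_jexp_sub_le X Y hX
  have h2 : ‖Y‖ ≤ ‖jexp X Y‖ + ‖jexp X Y - Y‖ := by
    have := norm_sub_le (jexp X Y) (jexp X Y - Y)
    rwa [sub_sub_cancel] at this
  nlinarith

/-- `J_X` is injective for `15|X| < 1`. [folklore] -/
theorem jexp_injective (X : 𝕄) (hX : 15 * ‖X‖ < 1) {Y Z : 𝕄} (h : jexp X Y = jexp X Z) : Y = Z := by
  have hX1 : ‖X‖ ≤ 1 := by nlinarith [norm_nonneg X]
  have h1 := norm_le_norm_jexp X (Y - Z) hX1
  rw [jexp_sub, h, sub_self, norm_zero] at h1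
  have h2 : 0 < 1 - 15 * ‖X‖ := by linarith
  have h3 : ‖Y - Z‖ ≤ 0 := le_of_not_gt fun hc => absurd h1 (not_le.mpr (mul_pos h2 hc))
  exact sub_eq_zero.mp (norm_le_zero_iff.mp h3)

/-! ## §2 Linearity, support and reversal rules for `(δ_ψV)(Γ)` -/

/-- `δ` is additive in the direction. [folklore] -/
theorem dhol_add (V : Site d → Fin d → 𝕄ˣ) (ψ₁ ψ₂ : Site d → Fin d → 𝕄) :
    ∀ (x : Site d) (w : List (Letter d)), dhol V (ψ₁ + ψ₂) x w = dhol V ψ₁ x w + dhol V ψ₂ x w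
  | x, [] => by simp
  | x, l :: w => by
    have hstep : dstep V (ψ₁ + ψ₂) x l = dstep V ψ₁ x l + dstep V ψ₂ x l := by
      obtain ⟨μ, b⟩ := l
      cases b
      · simp only [dstep, Bool.false_eq_true, ↓reduceIte, Pi.add_apply, neg_add]
      · simp only [dstep, ↓reduceIte, Pi.add_apply, Ad_add]
    rw [dhol_cons, dhol_cons, dhol_cons, hstep, dhol_add V ψ₁ ψ₂ (x + l.vec) w, Ad_add]
    abel

/-- `δ` is real-homogeneous in the direction. [folklore] -/
theorem dhol_smul (V : Site d → Fin d → 𝕄ˣ) (c : ℝ) (ψ : Site d → Fin d → 𝕄) :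
    ∀ (x : Site d) (w : List (Letter d)), dhol V (c • ψ) x w = c • dhol V ψ x w
  | x, [] => by simp
  | x, l :: w => by
    have hstep : dstep V (c • ψ) x l = c • dstep V ψ x l := by
      obtain ⟨μ, b⟩ := l
      cases b
      · simp only [dstep, Bool.false_eq_true, ↓reduceIte, Pi.smul_apply, smul_neg]
      · simp only [dstep, ↓reduceIte, Pi.smul_apply, Ad_real_smul]
    rw [dhol_cons, dhol_cons, hstep, dhol_smul V c ψ (x + l.vec) w, Ad_real_smul, smul_add]

/-- `δ` of the negated direction. [folklore] -/
theorem dhol_neg (V : Site d → Fin d → 𝕄ˣ) (ψ : Site d → Fin d → 𝕄) (x : Site d) (w : List (Letter d)) :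
    dhol V (-ψ) x w = -dhol V ψ x w := by
  have h := dhol_smul V (-1 : ℝ) ψ x w
  simp only [neg_smul, one_smul] at h
  exact h

/-- `δ` of a difference of directions. [folklore] -/
theorem dhol_sub (V : Site d → Fin d → 𝕄ˣ) (ψ₁ ψ₂ : Site d → Fin d → 𝕄) (x : Site d) (w : List (Letter d)) :
    dhol V (ψ₁ - ψ₂) x w = dhol V ψ₁ x w - dhol V ψ₂ x w := by
  rw [sub_eq_add_neg, dhol_add, dhol_neg, ← sub_eq_add_neg]

/-- **LOCALITY OF `δ`**: if the direction vanishes on every bond of the word, `(δ_ψV)(Γ) = 0`. [folklore] -/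
theorem dhol_eq_zero_of_forall (V : Site d → Fin d → 𝕄ˣ) {ψ : Site d → Fin d → 𝕄} :
    ∀ (x : Site d) (w : List (Letter d)), (∀ b ∈ bondsOf x w, ψ b.1 b.2 = 0) → dhol V ψ x w = 0
  | x, [], _ => by simp
  | x, l :: w, h => by
    have hb := h (if l.2 then (x, l.1) else (x + l.vec, l.1)) (by simp)
    have hstep : dstep V ψ x l = 0 := by
      obtain ⟨μ, b⟩ := l
      cases b
      · simp only [Bool.false_eq_true, ↓reduceIte] at hb
        simp only [dstep, Bool.false_eq_true, ↓reduceIte, hb, neg_zero]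
      · simp only [↓reduceIte] at hb
        simp only [dstep, ↓reduceIte, hb, Ad_zero]
    rw [dhol_cons, hstep, dhol_eq_zero_of_forall V (x + l.vec) w fun b hb' => h b (by simp [hb']), Ad_zero,
      add_zero]

/-- `δ` depends on the direction only through its values on the bonds of the word. [folklore] -/
theorem dhol_congr (V : Site d → Fin d → 𝕄ˣ) {ψ ψ' : Site d → Fin d → 𝕄} (x : Site d) (w : List (Letter d))
    (h : ∀ b ∈ bondsOf x w, ψ b.1 b.2 = ψ' b.1 b.2) : dhol V ψ x w = dhol V ψ' x w := by
  have h0 := dhol_eq_zero_of_forall V (ψ := ψ - ψ') x w fun b hb => by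
    simp only [Pi.sub_apply, h b hb, sub_self]
  rwa [dhol_sub, sub_eq_zero] at h0

/-- **`δ` OF A REVERSED WORD**: `(δ_ψV)(Γ⁻¹) = −Ad_{V(Γ)⁻¹}(δ_ψV)(Γ)` (both are the left-trivialised derivative of
`s ↦ V_s(Γ)⁻¹`). [folklore] -/
theorem dhol_revWord (V : Site d → Fin d → 𝕄ˣ) (ψ : Site d → Fin d → 𝕄) (x : Site d) (w : List (Letter d)) :
    dhol V ψ (x + disp w) (revWord w) = -Ad (hol V x w)⁻¹ (dhol V ψ x w) := by
  have h1 := hasDerivAt_val_hol_vary_word V ψ (revWord w) (x + disp w)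
  have h2 := hasDerivAt_units_inv (u := fun s : ℝ => hol (vary V ψ s) x w) (δ := dhol V ψ x w)
    (by simpa only [vary_zero] using hasDerivAt_val_hol_vary_word V ψ w x)
  simp only [vary_zero] at h2
  have e1 : (fun s : ℝ => ((hol (vary V ψ s) (x + disp w) (revWord w) : 𝕄ˣ) : 𝕄))
      = fun s : ℝ => (((hol (vary V ψ s) x w)⁻¹ : 𝕄ˣ) : 𝕄) := by
    funext s; rw [hol_revWord]
  rw [e1] at h1
  have h := h1.unique h2
  rw [hol_revWord] at h
  exact Units.mul_left_inj _ |>.mp h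

/-! ## §3 The bonds of concatenations, segments and tree words -/

omit [Fintype n] [DecidableEq n] in
/-- The bonds of a concatenation. [folklore] -/
theorem bondsOf_append : ∀ (x : Site d) (w₁ w₂ : List (Letter d)),
    bondsOf x (w₁ ++ w₂) = bondsOf x w₁ ++ bondsOf (x + disp w₁) w₂
  | x, [], w₂ => by simp
  | x, l :: w₁, w₂ => by
    rw [List.cons_append, bondsOf_cons, bondsOf_cons, bondsOf_append (x + l.vec) w₁ w₂, disp_cons, List.cons_append,
      add_assoc]

omit [Fintype n] [DecidableEq n] in
/-- The bonds of a forward segment: `(x + je_κ, κ)`, `j < k`. [folklore] -/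
theorem mem_bondsOf_seg_iff (x : Site d) (κ : Fin d) :
    ∀ (k : ℕ) (b : Site d × Fin d), b ∈ bondsOf x (seg κ (k : ℤ)) ↔ ∃ j : ℕ, j < k ∧ b = (x + (j : ℤ) • e κ, κ)
  | 0, b => by simp
  | k + 1, b => by
    rw [show ((k + 1 : ℕ) : ℤ) = (k : ℤ) + 1 by push_cast; rfl]
    rw [show seg κ ((k : ℤ) + 1) = (κ, true) :: seg κ (k : ℤ) by
      rw [show (k : ℤ) + 1 = ((k + 1 : ℕ) : ℤ) by push_cast; rfl, seg_natCast, seg_natCast, List.replicate_succ]]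
    rw [bondsOf_cons, List.mem_cons]
    simp only [↓reduceIte, Letter.vec_true]
    have ih := mem_bondsOf_seg_iff (x + e κ) κ k b
    constructor
    · rintro (rfl | hb)
      · exact ⟨0, Nat.succ_pos k, by simp⟩
      · obtain ⟨j, hj, rfl⟩ := ih.mp hb
        refine ⟨j + 1, by omega, ?_⟩
        simp only [Nat.cast_add, Nat.cast_one, add_smul, one_smul, Prod.mk.injEq, and_true]
        abel
    · rintro ⟨j, hj, rfl⟩
      rcases Nat.eq_zero_or_pos j with rfl | hj0
      · left; simp
      · right
        refine ih.mpr ⟨j - 1, by omega, ?_⟩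
        obtain ⟨i, rfl⟩ := Nat.exists_eq_add_of_lt hj0
        simp only [zero_add, Nat.add_sub_cancel, Nat.cast_add, Nat.cast_one, add_smul, one_smul, Prod.mk.injEq,
          and_true]
        abel

omit [Fintype n] [DecidableEq n] in
/-- The bonds of a backward segment from `x`: `(x − (j+1)e_κ, κ)`, `j < k`. [folklore] -/
theorem mem_bondsOf_seg_neg_iff (x : Site d) (κ : Fin d) :
    ∀ (k : ℕ) (b : Site d × Fin d),
      b ∈ bondsOf x (seg κ (-(k : ℤ))) ↔ ∃ j : ℕ, j < k ∧ b = (x - ((j : ℤ) + 1) • e κ, κ)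
  | 0, b => by simp
  | k + 1, b => by
    rw [show seg κ (-((k + 1 : ℕ) : ℤ)) = (κ, false) :: seg κ (-(k : ℤ)) by
      rw [seg_neg_natCast, seg_neg_natCast, List.replicate_succ]]
    rw [bondsOf_cons, List.mem_cons]
    simp only [Bool.false_eq_true, ↓reduceIte, Letter.vec_false]
    have ih := mem_bondsOf_seg_neg_iff (x + -e κ) κ k b
    constructor
    · rintro (rfl | hb)
      · exact ⟨0, Nat.succ_pos k, by simp [sub_eq_add_neg]⟩
      · obtain ⟨j, hj, rfl⟩ := ih.mp hb
        refine ⟨j + 1, by omega, ?_⟩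
        simp only [Nat.cast_add, Nat.cast_one, add_smul, one_smul, Prod.mk.injEq, and_true]
        abel
    · rintro ⟨j, hj, rfl⟩
      rcases Nat.eq_zero_or_pos j with rfl | hj0
      · left; simp [sub_eq_add_neg]
      · right
        refine ih.mpr ⟨j - 1, by omega, ?_⟩
        obtain ⟨i, rfl⟩ := Nat.exists_eq_add_of_lt hj0
        simp only [zero_add, Nat.add_sub_cancel, Nat.cast_add, Nat.cast_one, add_smul, one_smul, Prod.mk.injEq,
          and_true]
        abel

omit [Fintype n] [DecidableEq n] in
/-- The bonds of a flat-map of forward segments along DISTINCT axes with non-negative offsets `v`: a bond in direction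
`i` starts at a site whose `i`-th coordinate lies in `[x_i, x_i + v_i)`. [folklore] -/
theorem bondsOf_flatMap_seg_lt (v : Site d) (hv : ∀ i, 0 ≤ v i) :
    ∀ (axes : List (Fin d)), axes.Nodup → ∀ (x : Site d) (b : Site d × Fin d),
      b ∈ bondsOf x (axes.flatMap fun i => seg i (v i)) → b.2 ∈ axes ∧ x b.2 ≤ b.1 b.2 ∧ b.1 b.2 < x b.2 + v b.2
  | [], _, x, b, hb => by simp at hb
  | i :: axes, hnd, x, b, hb => by
    rw [List.flatMap_cons, bondsOf_append, List.mem_append] at hb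
    rw [List.nodup_cons] at hnd
    obtain ⟨hi, hnd'⟩ := hnd
    have hvi : v i = ((v i).toNat : ℤ) := (Int.toNat_of_nonneg (hv i)).symm
    rcases hb with hb | hb
    · rw [hvi] at hb
      obtain ⟨j, hj, rfl⟩ := (mem_bondsOf_seg_iff x i _ b).mp hb
      refine ⟨List.mem_cons_self, ?_, ?_⟩
      · simp [e_apply]
      · simp only [Pi.add_apply, Pi.smul_apply, e_apply, if_true, smul_eq_mul, mul_one]
        omega
    · have ih := bondsOf_flatMap_seg_lt v hv axes hnd' (x + disp (seg i (v i))) b hb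
      obtain ⟨hmem, h1, h2⟩ := ih
      have hne : b.2 ≠ i := fun h => hi (h ▸ hmem)
      rw [disp_seg] at h1 h2
      simp only [Pi.add_apply, Pi.smul_apply, e_apply, if_neg hne, smul_eq_mul, mul_zero, add_zero] at h1 h2
      exact ⟨List.mem_cons_of_mem _ hmem, h1, h2⟩

omit [Fintype n] [DecidableEq n] in
/-- **THE BONDS OF A TREE WORD** `Γ_{x, x+v}` (`v ≥ 0`): a bond of the tree word in direction `i` starts at a site whose
`i`-th coordinate lies in `[x_i, x_i + v_i)` — in particular tree words inside a block never reach the far face of the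
block. [cite: Balaban1985Averaging, p.24; Balaban1984PropagatorsI, (1.7) p.18] -/
theorem bondsOf_treeWord_lt (v : Site d) (hv : ∀ i, 0 ≤ v i) (x : Site d) (b : Site d × Fin d)
    (hb : b ∈ bondsOf x (treeWord v)) : x b.2 ≤ b.1 b.2 ∧ b.1 b.2 < x b.2 + v b.2 := by
  have h := bondsOf_flatMap_seg_lt v hv (List.finRange d).reverse
    (List.nodup_reverse.mpr (List.nodup_finRange d)) x b hb
  exact ⟨h.2.1, h.2.2⟩

/-! ## §4 Segments with one live bond -/

/-- **A FORWARD SEGMENT WITH ONE LIVE BOND**: if the direction vanishes on every bond `(x + je_κ, κ)`, `j < k`, except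
possibly `j = j₀`, then `(δ_ψV)(Γ) = Ad_{V(x, …, x + (j₀+1)e_κ)} ψ(x + j₀e_κ, κ)` (the live bond dressed by the transport up
to and including it). [cite: Balaban1985Averaging, (9) p.18, (56) p.27] -/
theorem dhol_seg_single (V : Site d → Fin d → 𝕄ˣ) {ψ : Site d → Fin d → 𝕄} (x : Site d) (κ : Fin d) {k j₀ : ℕ}
    (hj₀ : j₀ < k) (hψ : ∀ j : ℕ, j < k → j ≠ j₀ → ψ (x + (j : ℤ) • e κ) κ = 0) :
    dhol V ψ x (seg κ (k : ℤ)) = Ad (hol V x (seg κ ((j₀ : ℤ) + 1))) (ψ (x + (j₀ : ℤ) • e κ) κ) := by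
  obtain ⟨i, rfl⟩ := Nat.exists_eq_add_of_lt hj₀
  -- split the segment: `seg κ (j₀ + i + 1) = seg κ j₀ ++ ((κ,true) :: seg κ i)`
  have hsplit : seg κ ((j₀ + i + 1 : ℕ) : ℤ) = seg κ (j₀ : ℤ) ++ ((κ, true) :: seg κ (i : ℤ)) := by
    rw [seg_natCast, seg_natCast, seg_natCast, ← List.replicate_succ, ← List.replicate_add, Nat.add_assoc]
  rw [hsplit, dhol_append, disp_seg, dhol_cons]
  -- the prefix vanishes
  have h1 : dhol V ψ x (seg κ (j₀ : ℤ)) = 0 := by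
    refine dhol_eq_zero_of_forall V x _ fun b hb => ?_
    obtain ⟨j, hj, rfl⟩ := (mem_bondsOf_seg_iff x κ j₀ b).mp hb
    exact hψ j (by omega) (by omega)
  -- the suffix vanishes
  have h2 : dhol V ψ (x + (j₀ : ℤ) • e κ + Letter.vec ((κ, true) : Letter d)) (seg κ (i : ℤ)) = 0 := by
    refine dhol_eq_zero_of_forall V _ _ fun b hb => ?_
    obtain ⟨j, hj, rfl⟩ := (mem_bondsOf_seg_iff _ κ i b).mp hb
    have := hψ (j₀ + 1 + j) (by omega) (by omega)
    simp only [Letter.vec_true]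
    rw [show x + (j₀ : ℤ) • e κ + e κ + (j : ℤ) • e κ = x + ((j₀ + 1 + j : ℕ) : ℤ) • e κ by push_cast; module]
    exact this
  rw [h1, h2, Ad_zero, add_zero, zero_add, dstep_true, ← Ad_mul, ← hol_seg_natCast_succ]

/-- **A BACKWARD SEGMENT WHOSE ONLY LIVE BOND IS THE FIRST**: if the direction vanishes on the bonds
`(x − (j+2)e_κ, κ)`, `j < k`, then `(δ_ψV)(x; −(k+1)e_κ) = −ψ(x − e_κ, κ)`. [cite: Balaban1985Averaging, (9) p.18] -/
theorem dhol_seg_neg_head (V : Site d → Fin d → 𝕄ˣ) {ψ : Site d → Fin d → 𝕄} (x : Site d) (κ : Fin d) (k : ℕ)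
    (hψ : ∀ j : ℕ, j < k → ψ (x - ((j : ℤ) + 2) • e κ) κ = 0) :
    dhol V ψ x (seg κ (-((k + 1 : ℕ) : ℤ))) = -ψ (x - e κ) κ := by
  rw [show seg κ (-((k + 1 : ℕ) : ℤ)) = (κ, false) :: seg κ (-(k : ℤ)) by
    rw [seg_neg_natCast, seg_neg_natCast, List.replicate_succ]]
  rw [dhol_cons, dstep_false]
  have h2 : dhol V ψ (x + Letter.vec ((κ, false) : Letter d)) (seg κ (-(k : ℤ))) = 0 := by
    refine dhol_eq_zero_of_forall V _ _ fun b hb => ?_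
    obtain ⟨j, hj, rfl⟩ := (mem_bondsOf_seg_neg_iff _ κ k b).mp hb
    have := hψ j hj
    simp only [Letter.vec_false]
    rw [show x + -e κ - ((j : ℤ) + 1) • e κ = x - ((j : ℤ) + 2) • e κ by module]
    exact this
  rw [h2, Ad_zero, add_zero]

end

end Summit.QuantumFields.BalabanUV.T4Continuum.AveragingDeficitTransportCalc
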